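/-
Copyright: the b2b-balaban T⁴-continuum CRUX team, row NE7b OWNER lineage `t4-ne7b-p1` (gen 145). Project licence.
-/
import Summits.QuantumFields.BalabanUV.T4Continuum.Spine.NE7b.SupWhitenedMixedThirdCumulantEntry
import Summits.QuantumFields.BalabanUV.T4Continuum.Spine.NE7b.SupWeightedSlotTools

/-!
# THE HOMOGENEOUS BOUND FOR THE MIXED THIRD CUMULANT AND THE INTERPOLATED THREE-POINT ENTRY (SCOPING-d17 (R-a), the repair of the
# located NO (648), second file).  (507)∕(508) bound `κ₃(U″e_xe_y; U′e_z, U′e_t)` under the tilted law by the TREE bound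
# `Q = 4√(MK)∕(ρ_{xz}ρ_{xt})` — decay from the Hessian site `x` to both gradient legs, but NO dependence on the pair partner `y` (the Hessian
# vector's profile letters are suprema over the pair), whence (525)∕(526)'s support indicator `𝟙[Hk_{yx} ≠ 0]` and the COUNTING letter `n`
# that (648) showed is not reproduced.  Here the complementary HOMOGENEOUS bound: the Hessian vertex is bounded POINTWISE by its entry
# majorant, `|U″(·)[e_x,e_y]| ≤ Hk_{yx}` (`hHk`), so `|G − E_νG| ≤ 2Hk_{yx}` and, by Cauchy–Schwarz in `L²(ν)` and `(∫F̂²)² ≤ ∫F̂⁴ ≤ M₁`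
# (`M₁ = 5κ₂⁴γ_op²∕(1−λγ_op)²`, (465)),
#   `|E_ν(G − EG)(F_z − EF_z)(F_t − EF_t)| ≤ P := 2·Hk_{yx}·√M₁`   (Gibbs format §2, tilted format under `N(0,AAᵀ)` §3)
# — degree ONE in `Hk_{yx}`, no decay.  THE END (§4): the INTERPOLATED ENTRY `|κ₃| ≤ √(P·Q) = √(2Hk_{yx}√M₁·4√(MK)) ∕ √(ρ_{xz}ρ_{xt})`
# ((649) `abs_le_sqrt_mul_of_le`): half the tree decay AND the factor `√Hk_{yx}`, which the slot sums take against a WEIGHTED row∕column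
# letter of `Hk` by (649) `sum_sqrt_mul_le_weighted` — no support count (row NE7b, node U5c; (465), (507), (508), (649) BY NAME; [folklore]).

Cell `pub-balaban`, sub-cell `t4`, spine estimate NE7b (`T4WeightBudget.RelWeightBound`; the cell's OWN estimate — NOT PRINTED in
[Bałaban 1983–89], NOT PROVED).  Crux-route work under `Spine/NE7b/` by the row OWNER (`t4-ne7b-p1` gen 145, file (650)) under FREEZE
(0)'s crux-prover clause; NOTHING of Bałaban's is named as a Lean object, valued or asserted; no `T4Continuum/Support` leaf typed; no
`def`, no notation; zero `sorry`.  Imports (BY NAME): the OWNER's (508) `…SupWhitenedMixedThirdCumulantEntry` ((507), (465), (458), (457)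
through it), (649) `…SupWeightedSlotTools`.

WHAT IS PROVED ([folklore]): §1 (any probability measure) `integrable_sq_of_pow_four`, `sq_integral_sq_le`, `integral_abs_mul_le_sqrt`,
**`centred_triple_le_of_bounded_vertex`**; §2 **`whitened_mixed_third_cumulant_homogeneous`** (Gibbs format); §3
**`homogeneous_mixed_third_cumulant_entry`** (tilted format); §4 THE END **`interpolated_mixed_third_cumulant_entry`**; §5 toy.

HONEST (what this is NOT).  One placement (the Hessian pair `(x,y)` with the row∕tilt index among the gradient legs is (509)'s placement —
same two files' pattern, successor); the interpolated ENTRY MAJORANT `M₄′` ((526)′), its weighted slot letters and the weighted output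
letters are the next files (SCOPING-d17 (R-a)–(R-c)); the interpolation halves the decay rate ((R-d) books it); scalar skeleton ((A3),
NC-NE7b-α UNRULED); nothing of Bałaban's asserted.  BY-NAME EFFECT ON THE WALL: NONE.  NE7b NOT PRINTED ∕ NOT PROVED; spine PROVED 0∕9; rung
(B)+1 — the programme's measures remain FINITE-torus statements; NOT the mass gap, NOT Clay.  HONEST DEPENDENCY: continuum YM on T⁴ ⇐
BetaPertH ∧ nine spine estimates (0∕9 proved); BetaPertH ⇐ (D1) ∧ (D4) ∧ CAP+tail; G-an2-4 gates asym, D1 and NE2∕3∕4.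
-/

set_option autoImplicit false
set_option maxSynthPendingDepth 2

noncomputable section

namespace Summit.QuantumFields.BalabanUV.T4Continuum.NE7b.SupHomogeneousThreePoint

open MeasureTheory ProbabilityTheory Real Set Function Finset Matrix
open scoped BigOperators
open Literature.Probability.Distributions (matrixCLM)
open SupWhitenedFourthMoment (whitened_fourth_moment_gibbs whitened_fourth_power_integrable)
open SupWhitenedMomentLetters (op_letter_nonneg whitened_exp_integrable)
open SupWhitenedCovarianceKernelLetter (whitened_integrable_lebesgue)
open SupWhitenedThirdKernelLetter (whitened_mean_bridge)
open SupWhitenedMixedThirdCumulantEntry (whitened_hess_mean_bridge whitened_mixed_triple_bridge whitened_mixed_third_cumulant_entry)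
open SupEffectiveActionDerivative (mul_opBound_le_of_le)
open SupWeightedSlotTools (weighted_integral_cauchy_schwarz abs_le_sqrt_mul_of_le)

/-! ## §1. A bounded centred vertex against two observables with fourth-moment letters (any probability measure) -/

section Abstract

variable {Ω : Type*} [MeasurableSpace Ω] {ν : Measure Ω} [IsProbabilityMeasure ν]

/-- `f² ∈ L¹` from `f⁴ ∈ L¹` on a probability space (`x² ≤ 1 + x⁴`). [folklore] -/
theorem integrable_sq_of_pow_four {f : Ω → ℝ} (hfm : AEStronglyMeasurable f ν) (h4 : Integrable (fun ω => f ω ^ 4) ν) :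
    Integrable (fun ω => f ω ^ 2) ν := by
  refine ((integrable_const (1 : ℝ)).add h4).mono' (hfm.pow 2) (ae_of_all _ fun ω => ?_)
  simp only [Pi.add_apply]
  rw [Real.norm_eq_abs, abs_of_nonneg (sq_nonneg _)]
  nlinarith [sq_nonneg (f ω ^ 2 - 1), sq_nonneg (f ω)]

/-- `(∫f²)² ≤ ∫f⁴` on a probability space (Cauchy–Schwarz against `1`). [folklore] -/
theorem sq_integral_sq_le {f : Ω → ℝ} (hfm : AEStronglyMeasurable f ν) (h4 : Integrable (fun ω => f ω ^ 4) ν) :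
    (∫ ω, f ω ^ 2 ∂ν) ^ 2 ≤ ∫ ω, f ω ^ 4 ∂ν := by
  have h2 := integrable_sq_of_pow_four hfm h4
  have h := weighted_integral_cauchy_schwarz (μ := ν) (w := fun _ => (1 : ℝ)) (f := fun ω => f ω ^ 2) (g := fun _ => (1 : ℝ))
    (fun _ => zero_le_one) (by simpa only [one_mul, mul_one] using h2)
    (by simpa only [one_mul, ← pow_mul] using h4) (by simpa only [one_mul, one_pow] using integrable_const (1 : ℝ))
  simp only [one_mul, mul_one, one_pow, integral_const, probReal_univ, smul_eq_mul, ← pow_mul] at h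
  simpa using h

/-- `∫|f||g| ≤ √(∫f²)·√(∫g²)` on a probability space, for `f, g` with fourth moments. [folklore] -/
theorem integral_abs_mul_le_sqrt {f g : Ω → ℝ} (hfm : AEStronglyMeasurable f ν) (hgm : AEStronglyMeasurable g ν)
    (hf4 : Integrable (fun ω => f ω ^ 4) ν) (hg4 : Integrable (fun ω => g ω ^ 4) ν) :
    ∫ ω, |f ω| * |g ω| ∂ν ≤ Real.sqrt (∫ ω, f ω ^ 2 ∂ν) * Real.sqrt (∫ ω, g ω ^ 2 ∂ν) := by
  have hf2 := integrable_sq_of_pow_four hfm hf4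
  have hg2 := integrable_sq_of_pow_four hgm hg4
  have hfg : Integrable (fun ω => |f ω| * |g ω|) ν := by
    refine ((hf2.add hg2).div_const 2).mono' (hfm.norm.mul hgm.norm) (ae_of_all _ fun ω => ?_)
    simp only [Pi.add_apply]
    rw [Real.norm_eq_abs, abs_of_nonneg (mul_nonneg (abs_nonneg _) (abs_nonneg _))]
    nlinarith [sq_nonneg (|f ω| - |g ω|), sq_abs (f ω), sq_abs (g ω)]
  have h := weighted_integral_cauchy_schwarz (μ := ν) (w := fun _ => (1 : ℝ)) (f := fun ω => |f ω|) (g := fun ω => |g ω|)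
    (fun _ => zero_le_one) (by simpa only [one_mul] using hfg) (by simpa only [one_mul, sq_abs] using hf2)
    (by simpa only [one_mul, sq_abs] using hg2)
  simp only [one_mul, sq_abs] at h
  rw [← Real.sqrt_mul (integral_nonneg fun ω => sq_nonneg _)]
  exact Real.le_sqrt_of_sq_le h

/-- **A BOUNDED CENTRED VERTEX AGAINST TWO OBSERVABLES**: `|B − m_B| ≤ 2β` pointwise and fourth centred moments `≤ m₄` give
`|∫(B − m_B)(F − m_F)(G − m_G)dν| ≤ 2β·√m₄` — NO decay, degree one in `β`. [folklore] -/
theorem centred_triple_le_of_bounded_vertex {B F G : Ω → ℝ} {mB mF mG β m₄ : ℝ} (hβ : 0 ≤ β) (hB : ∀ ω, |B ω - mB| ≤ 2 * β)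
    (hFm : AEStronglyMeasurable (fun ω => F ω - mF) ν) (hGm : AEStronglyMeasurable (fun ω => G ω - mG) ν)
    (hF4 : Integrable (fun ω => (F ω - mF) ^ 4) ν) (hG4 : Integrable (fun ω => (G ω - mG) ^ 4) ν)
    (hmF : ∫ ω, (F ω - mF) ^ 4 ∂ν ≤ m₄) (hmG : ∫ ω, (G ω - mG) ^ 4 ∂ν ≤ m₄) :
    |∫ ω, (B ω - mB) * (F ω - mF) * (G ω - mG) ∂ν| ≤ 2 * β * Real.sqrt m₄ := by
  have hfg : Integrable (fun ω => |F ω - mF| * |G ω - mG|) ν := by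
    have hf2 := integrable_sq_of_pow_four hFm hF4
    have hg2 := integrable_sq_of_pow_four hGm hG4
    refine ((hf2.add hg2).div_const 2).mono' (hFm.norm.mul hGm.norm) (ae_of_all _ fun ω => ?_)
    simp only [Pi.add_apply]
    rw [Real.norm_eq_abs, abs_of_nonneg (mul_nonneg (abs_nonneg _) (abs_nonneg _))]
    nlinarith [sq_nonneg (|F ω - mF| - |G ω - mG|), sq_abs (F ω - mF), sq_abs (G ω - mG)]
  -- `|∫(B−m)F̂Ĝ| ≤ 2β∫|F̂||Ĝ|`
  have h1 : |∫ ω, (B ω - mB) * (F ω - mF) * (G ω - mG) ∂ν| ≤ 2 * β * ∫ ω, |F ω - mF| * |G ω - mG| ∂ν := by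
    rw [← integral_const_mul]
    refine abs_integral_le_integral_abs.trans (integral_mono_of_nonneg (ae_of_all _ fun ω => abs_nonneg _) (hfg.const_mul _)
      (ae_of_all _ fun ω => ?_))
    dsimp only
    rw [abs_mul, abs_mul]
    calc |B ω - mB| * |F ω - mF| * |G ω - mG| ≤ 2 * β * |F ω - mF| * |G ω - mG| := by gcongr; exact hB ω
      _ = 2 * β * (|F ω - mF| * |G ω - mG|) := by ring
  -- Cauchy–Schwarz and the fourth moments
  have h2 := integral_abs_mul_le_sqrt hFm hGm hF4 hG4
  have hF2 : ∫ ω, (F ω - mF) ^ 2 ∂ν ≤ Real.sqrt m₄ := Real.le_sqrt_of_sq_le ((sq_integral_sq_le hFm hF4).trans hmF)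
  have hG2 : ∫ ω, (G ω - mG) ^ 2 ∂ν ≤ Real.sqrt m₄ := Real.le_sqrt_of_sq_le ((sq_integral_sq_le hGm hG4).trans hmG)
  have h3 : Real.sqrt (∫ ω, (F ω - mF) ^ 2 ∂ν) * Real.sqrt (∫ ω, (G ω - mG) ^ 2 ∂ν) ≤ Real.sqrt m₄ :=
    calc Real.sqrt (∫ ω, (F ω - mF) ^ 2 ∂ν) * Real.sqrt (∫ ω, (G ω - mG) ^ 2 ∂ν)
        ≤ Real.sqrt (Real.sqrt m₄) * Real.sqrt (Real.sqrt m₄) :=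
          mul_le_mul (Real.sqrt_le_sqrt hF2) (Real.sqrt_le_sqrt hG2) (Real.sqrt_nonneg _) (Real.sqrt_nonneg _)
      _ = Real.sqrt m₄ := Real.mul_self_sqrt (Real.sqrt_nonneg _)
  calc |∫ ω, (B ω - mB) * (F ω - mF) * (G ω - mG) ∂ν| ≤ 2 * β * ∫ ω, |F ω - mF| * |G ω - mG| ∂ν := h1
    _ ≤ 2 * β * (Real.sqrt (∫ ω, (F ω - mF) ^ 2 ∂ν) * Real.sqrt (∫ ω, (G ω - mG) ^ 2 ∂ν)) := mul_le_mul_of_nonneg_left h2 (by positivity)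
    _ ≤ 2 * β * Real.sqrt m₄ := mul_le_mul_of_nonneg_left h3 (by positivity)

end Abstract

/-! ## §2. The homogeneous bound, Gibbs format ((507)′) -/

section Whitened

variable {ι κ : Type} [Fintype ι] [DecidableEq ι] [Fintype κ] [DecidableEq κ]

variable {U : EuclideanSpace ℝ ι → ℝ} {U' : EuclideanSpace ℝ ι → EuclideanSpace ℝ ι →L[ℝ] ℝ}
  {U'' : EuclideanSpace ℝ ι → EuclideanSpace ℝ ι →L[ℝ] EuclideanSpace ℝ ι →L[ℝ] ℝ}
  {U₃ : EuclideanSpace ℝ ι → EuclideanSpace ℝ ι →L[ℝ] EuclideanSpace ℝ ι →L[ℝ] EuclideanSpace ℝ ι →L[ℝ] ℝ} {Hk : ι → ι → ℝ} {K3 : ι → ι → ι → ℝ}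
  {A : Matrix ι κ ℝ} {D : κ → κ → ℝ} {γop κ₀ κ₁ κ₂ κ₃ a τ δ θp lam lamA αr αc hr γ dθ dθ' αθ βθ : ℝ} {θ : κ → κ → ℝ} {σ : ι → κ → ℝ}
  {ρ : ι → ι → ℝ}

/-- **THE HOMOGENEOUS BOUND FOR THE MIXED THIRD CUMULANT (Gibbs format)**: with the Hessian vertex bounded by its entry majorant,
`|∫(G_{xy} − EG_{xy})(F_z − EF_z)(F_t − EF_t)dν| ≤ 2·Hk_{yx}·√(5κ₂⁴γ_op²∕(1−λγ_op)²)` — NO decay, degree one in `Hk_{yx}`; `U ∈ C²` suffices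
(no `U‴`, no `D`, no weights). [folklore] -/
theorem whitened_mixed_third_cumulant_homogeneous [Nonempty κ] (hΓop : (γop • (1 : Matrix ι ι ℝ) - A * Aᵀ).PosSemidef) (Y : Finset ι)
    (hUd : ∀ φ : EuclideanSpace ℝ ι, HasFDerivAt U (U' φ) φ) (hU'd : ∀ φ : EuclideanSpace ℝ ι, HasFDerivAt U' (U'' φ) φ) (hU''c : Continuous U'')
    (hκ₀ : 0 ≤ κ₀) (hκ₁ : 0 ≤ κ₁) (ha : 0 ≤ a) (hτ : 0 < τ) (hδ : 0 < δ) (hθ0 : 0 < θp) (hθ1 : θp < 1) (hκθ : (2 * κ₀ * (1 + τ) + 4 * δ) * γop ≤ θp)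
    (hstab : ∀ φ : EuclideanSpace ℝ ι, -(κ₀ * ∑ x ∈ Y, φ x ^ 2) ≤ U φ) (hU'b : ∀ φ : EuclideanSpace ℝ ι, ‖U' φ‖ ≤ κ₁ * (a + ∑ x ∈ Y, φ x ^ 2))
    (hU''b : ∀ φ : EuclideanSpace ℝ ι, ‖U'' φ‖ ≤ κ₂) (hlam : 0 ≤ lam)
    (hUsec : ∀ s : ℝ, 0 ≤ s → s ≤ 1 → ∀ a b : EuclideanSpace ℝ ι, U ((1 - s) • a + s • b) - lam / 2 * (s * (1 - s)) * ∑ i, (a i - b i) ^ 2 ≤ (1 -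
        s) * U a + s * U b)
    (hρ : lam * γop < 1) (hHk : ∀ (φ : EuclideanSpace ℝ ι) (x z : ι), |U'' φ (EuclideanSpace.single z (1 : ℝ)) (EuclideanSpace.single x (1 : ℝ))| ≤
        Hk x z)
    (ψ : EuclideanSpace ℝ ι) (x y z t : ι) :
    |∫ w, (U'' (matrixCLM A (WithLp.toLp 2 w) + ψ) (EuclideanSpace.single x (1 : ℝ)) (EuclideanSpace.single y (1 : ℝ)) - ∫ w', U'' (matrixCLM A
        (WithLp.toLp 2 w') + ψ) (EuclideanSpace.single x (1 : ℝ)) (EuclideanSpace.single y (1 : ℝ)) ∂((volume : Measure (κ → ℝ)).tilted fun z =>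
        -(1 / 2 * (z ⬝ᵥ z) + U (matrixCLM A (WithLp.toLp 2 z) + ψ)))) * (U' (matrixCLM A (WithLp.toLp 2 w) + ψ) (EuclideanSpace.single z (1 : ℝ)) -
        ∫ w', U' (matrixCLM A (WithLp.toLp 2 w') + ψ) (EuclideanSpace.single z (1 : ℝ)) ∂((volume : Measure (κ → ℝ)).tilted fun z => -(1 / 2 * (z
        ⬝ᵥ z) + U (matrixCLM A (WithLp.toLp 2 z) + ψ)))) * (U' (matrixCLM A (WithLp.toLp 2 w) + ψ) (EuclideanSpace.single t (1 : ℝ)) - ∫ w', U'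
        (matrixCLM A (WithLp.toLp 2 w') + ψ) (EuclideanSpace.single t (1 : ℝ)) ∂((volume : Measure (κ → ℝ)).tilted fun z => -(1 / 2 * (z ⬝ᵥ z) + U
        (matrixCLM A (WithLp.toLp 2 z) + ψ)))) ∂((volume : Measure (κ → ℝ)).tilted fun z => -(1 / 2 * (z ⬝ᵥ z) + U (matrixCLM A (WithLp.toLp 2 z) +
        ψ)))| ≤
      2 * Hk y x * Real.sqrt (5 * (κ₂ ^ 4 * γop ^ 2) / (1 - lam * γop) ^ 2) := by
  haveI : Nonempty ι := ⟨x⟩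
  have hUc : Continuous U := continuous_iff_continuousAt.2 fun φ => (hUd φ).continuousAt
  have hU'c : Continuous U' := continuous_iff_continuousAt.2 fun φ => (hU'd φ).continuousAt
  have hγop := op_letter_nonneg hΓop
  have hκθ₀ : 2 * κ₀ * (1 + τ) * γop ≤ θp := mul_opBound_le_of_le (by positivity) (by linarith) hθ0.le hκθ
  have hI0 := whitened_exp_integrable hΓop Y hUc.measurable hκ₀ hτ hθ1 hκθ₀ hstab ψ
  have hV0 : Integrable (fun z : κ → ℝ => exp (-(1 / 2 * (z ⬝ᵥ z) + U (matrixCLM A (WithLp.toLp 2 z) + ψ)))) := by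
    have h := whitened_integrable_lebesgue A ψ (k := fun _ => (1 : ℝ)) (by simpa only [mul_one] using hI0)
    simpa only [one_mul] using h
  haveI : IsProbabilityMeasure ((volume : Measure (κ → ℝ)).tilted fun z => -(1 / 2 * (z ⬝ᵥ z) + U (matrixCLM A (WithLp.toLp 2 z) + ψ))) :=
        isProbabilityMeasure_tilted hV0
  have h4 := fun v => whitened_fourth_moment_gibbs hΓop Y hUd hU'd hU''c hκ₀ hκ₁ ha hτ hδ hθ0 hθ1 hκθ hstab hU'b hU''b hlam hUsec hρ ψ v
  have hI4 := fun v c => whitened_fourth_power_integrable hΓop Y hUd hU'd hκ₀ hκ₁ ha hτ hδ hθ0 hθ1 hκθ hstab hU'b ψ v c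
  have hsh : Continuous fun w : κ → ℝ => matrixCLM A (WithLp.toLp 2 w) + ψ :=
    ((matrixCLM A).continuous.comp (PiLp.continuous_toLp 2 _)).add continuous_const
  have hFm : ∀ (v : ι) (c : ℝ), AEStronglyMeasurable (fun w : κ → ℝ => U' (matrixCLM A (WithLp.toLp 2 w) + ψ) (EuclideanSpace.single v (1 : ℝ))
      - c) ((volume : Measure (κ → ℝ)).tilted fun z => -(1 / 2 * (z ⬝ᵥ z) + U (matrixCLM A (WithLp.toLp 2 z) + ψ))) :=
    fun v c => (((hU'c.comp hsh).clm_apply continuous_const).sub continuous_const).aestronglyMeasurable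
  have hβ : 0 ≤ Hk y x := (abs_nonneg _).trans (hHk ψ y x)
  have hB : ∀ w : κ → ℝ, |U'' (matrixCLM A (WithLp.toLp 2 w) + ψ) (EuclideanSpace.single x (1 : ℝ)) (EuclideanSpace.single y (1 : ℝ)) -
      ∫ w', U'' (matrixCLM A (WithLp.toLp 2 w') + ψ) (EuclideanSpace.single x (1 : ℝ)) (EuclideanSpace.single y (1 : ℝ)) ∂((volume : Measure (κ →
        ℝ)).tilted fun z => -(1 / 2 * (z ⬝ᵥ z) + U (matrixCLM A (WithLp.toLp 2 z) + ψ)))| ≤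
      2 * Hk y x := fun w => by
    have h1 := hHk (matrixCLM A (WithLp.toLp 2 w) + ψ) y x
    have h2 : ‖∫ w', U'' (matrixCLM A (WithLp.toLp 2 w') + ψ) (EuclideanSpace.single x (1 : ℝ)) (EuclideanSpace.single y (1 : ℝ)) ∂((volume :
        Measure (κ → ℝ)).tilted fun z => -(1 / 2 * (z ⬝ᵥ z) + U (matrixCLM A (WithLp.toLp 2 z) + ψ)))‖ ≤
        Hk y x * (((volume : Measure (κ → ℝ)).tilted fun z => -(1 / 2 * (z ⬝ᵥ z) + U (matrixCLM A (WithLp.toLp 2 z) + ψ)))).real Set.univ :=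
      norm_integral_le_of_norm_le_const (Filter.Eventually.of_forall fun w' => by
        rw [Real.norm_eq_abs]; exact hHk (matrixCLM A (WithLp.toLp 2 w') + ψ) y x)
    rw [probReal_univ, mul_one, Real.norm_eq_abs] at h2
    exact (abs_sub _ _).trans (by linarith)
  exact centred_triple_le_of_bounded_vertex hβ hB (hFm z _) (hFm t _) (hI4 z _) (hI4 t _) (h4 z) (h4 t)

/-! ## §3. The homogeneous bound, tilted format under `N(0,AAᵀ)` ((508)′) -/

/-- **THE HOMOGENEOUS BOUND, TILTED FORMAT**: `|Z⁻¹∫e^{−U}(U″e_xe_y − g₀)(U′e_z − a_z)(U′e_t − a_t) dN(0,AAᵀ)| ≤ 2·Hk_{yx}·√(5κ₂⁴γ_op²∕(1−λγ_op)²)`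
with the tilted means `g₀, a_v` ((508)'s bridges). [folklore] -/
theorem homogeneous_mixed_third_cumulant_entry [Nonempty κ] (hΓop : (γop • (1 : Matrix ι ι ℝ) - A * Aᵀ).PosSemidef) (Y : Finset ι)
    (hUd : ∀ φ : EuclideanSpace ℝ ι, HasFDerivAt U (U' φ) φ) (hU'd : ∀ φ : EuclideanSpace ℝ ι, HasFDerivAt U' (U'' φ) φ) (hU''c : Continuous U'')
    (hκ₀ : 0 ≤ κ₀) (hκ₁ : 0 ≤ κ₁) (ha : 0 ≤ a) (hτ : 0 < τ) (hδ : 0 < δ) (hθ0 : 0 < θp) (hθ1 : θp < 1) (hκθ : (2 * κ₀ * (1 + τ) + 4 * δ) * γop ≤ θp)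
    (hstab : ∀ φ : EuclideanSpace ℝ ι, -(κ₀ * ∑ x ∈ Y, φ x ^ 2) ≤ U φ) (hU'b : ∀ φ : EuclideanSpace ℝ ι, ‖U' φ‖ ≤ κ₁ * (a + ∑ x ∈ Y, φ x ^ 2))
    (hU''b : ∀ φ : EuclideanSpace ℝ ι, ‖U'' φ‖ ≤ κ₂) (hlam : 0 ≤ lam)
    (hUsec : ∀ s : ℝ, 0 ≤ s → s ≤ 1 → ∀ a b : EuclideanSpace ℝ ι, U ((1 - s) • a + s • b) - lam / 2 * (s * (1 - s)) * ∑ i, (a i - b i) ^ 2 ≤ (1 -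
        s) * U a + s * U b)
    (hρ : lam * γop < 1) (hHk : ∀ (φ : EuclideanSpace ℝ ι) (x z : ι), |U'' φ (EuclideanSpace.single z (1 : ℝ)) (EuclideanSpace.single x (1 : ℝ))| ≤
        Hk x z)
    (ψ : EuclideanSpace ℝ ι) (x y z t : ι) :
    |(∫ ω : EuclideanSpace ℝ ι, exp (-U (ω + ψ)) ∂(multivariateGaussian 0 (A * Aᵀ)))⁻¹ * (∫ ω : EuclideanSpace ℝ ι, exp (-U (ω + ψ)) * ((U'' (ω +
        ψ) (EuclideanSpace.single x (1 : ℝ)) (EuclideanSpace.single y (1 : ℝ)) - ((∫ ω : EuclideanSpace ℝ ι, exp (-U (ω + ψ))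
        ∂(multivariateGaussian 0 (A * Aᵀ)))⁻¹ * (∫ ω : EuclideanSpace ℝ ι, exp (-U (ω + ψ)) * U'' (ω + ψ) (EuclideanSpace.single x (1 : ℝ))
        (EuclideanSpace.single y (1 : ℝ)) ∂(multivariateGaussian 0 (A * Aᵀ))))) * (U' (ω + ψ) (EuclideanSpace.single z (1 : ℝ)) - ((∫ ω :
        EuclideanSpace ℝ ι, exp (-U (ω + ψ)) ∂(multivariateGaussian 0 (A * Aᵀ)))⁻¹ * (∫ ω : EuclideanSpace ℝ ι, exp (-U (ω + ψ)) * U' (ω + ψ)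
        (EuclideanSpace.single z (1 : ℝ)) ∂(multivariateGaussian 0 (A * Aᵀ))))) * (U' (ω + ψ) (EuclideanSpace.single t (1 : ℝ)) - ((∫ ω :
        EuclideanSpace ℝ ι, exp (-U (ω + ψ)) ∂(multivariateGaussian 0 (A * Aᵀ)))⁻¹ * (∫ ω : EuclideanSpace ℝ ι, exp (-U (ω + ψ)) * U' (ω + ψ)
        (EuclideanSpace.single t (1 : ℝ)) ∂(multivariateGaussian 0 (A * Aᵀ)))))) ∂(multivariateGaussian 0 (A * Aᵀ)))| ≤
      2 * Hk y x * Real.sqrt (5 * (κ₂ ^ 4 * γop ^ 2) / (1 - lam * γop) ^ 2) := by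
  have hUc : Continuous U := continuous_iff_continuousAt.2 fun φ => (hUd φ).continuousAt
  have hU'c : Continuous U' := continuous_iff_continuousAt.2 fun φ => (hU'd φ).continuousAt
  have h := whitened_mixed_third_cumulant_homogeneous hΓop Y hUd hU'd hU''c hκ₀ hκ₁ ha hτ hδ hθ0 hθ1 hκθ hstab hU'b hU''b hlam hUsec hρ hHk ψ x y z t
  rw [whitened_hess_mean_bridge hUc hU''c A ψ x y, whitened_mean_bridge hUc hU'c A ψ (EuclideanSpace.single z (1 : ℝ)),
    whitened_mean_bridge hUc hU'c A ψ (EuclideanSpace.single t (1 : ℝ)), whitened_mixed_triple_bridge hUc hU'c hU''c A ψ x y] at h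
  exact h

/-! ## §4. THE END: the interpolated three-point entry -/

/-- **THE END — THE INTERPOLATED THREE-POINT ENTRY**: the geometric mean of §3's homogeneous bound `P = 2Hk_{yx}√M₁` and (508)'s tree bound
`Q = 4√(MK)∕(ρ_{xz}ρ_{xt})`: `|κ₃ entry| ≤ √(P·4√(MK)) ∕ √(ρ_{xz}ρ_{xt})` — the factor `√Hk_{yx}` is summable in `y` against a weighted
letter, half the tree decay remains. [folklore] -/
theorem interpolated_mixed_third_cumulant_entry [Nonempty κ] (hΓop : (γop • (1 : Matrix ι ι ℝ) - A * Aᵀ).PosSemidef) (Y : Finset ι) (hUd : ∀ φ :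
        EuclideanSpace ℝ ι, HasFDerivAt U (U' φ) φ) (hU'd : ∀ φ : EuclideanSpace ℝ ι, HasFDerivAt U' (U'' φ) φ) (hU''d : ∀ φ : EuclideanSpace ℝ ι,
        HasFDerivAt U'' (U₃ φ) φ) (hU₃c : Continuous U₃) (hκ₀ : 0 ≤ κ₀) (hκ₁ : 0 ≤ κ₁) (ha : 0 ≤ a) (hτ : 0 < τ) (hδ : 0 < δ) (hθ0 : 0 < θp) (hθ1 :
        θp < 1) (hκθ : (2 * κ₀ * (1 + τ) + 4 * δ) * γop ≤ θp) (hκθw : 2 * κ₀ * (1 + τ) * γop + 4 * δ ≤ θp) (hstab : ∀ φ : EuclideanSpace ℝ ι, -(κ₀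
        * ∑ x ∈ Y, φ x ^ 2) ≤ U φ) (hU'b : ∀ φ : EuclideanSpace ℝ ι, ‖U' φ‖ ≤ κ₁ * (a + ∑ x ∈ Y, φ x ^ 2)) (hU''b : ∀ φ : EuclideanSpace ℝ ι, ‖U''
        φ‖ ≤ κ₂) (hU₃b : ∀ φ : EuclideanSpace ℝ ι, ‖U₃ φ‖ ≤ κ₃) (hlam : 0 ≤ lam) (hUsec : ∀ s : ℝ, 0 ≤ s → s ≤ 1 → ∀ a b : EuclideanSpace ℝ ι, U
        ((1 - s) • a + s • b) - lam / 2 * (s * (1 - s)) * ∑ i, (a i - b i) ^ 2 ≤ (1 - s) * U a + s * U b) (hρg : lam * γop < 1) (hHk : ∀ (φ :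
        EuclideanSpace ℝ ι) (x z : ι), |U'' φ (EuclideanSpace.single z (1 : ℝ)) (EuclideanSpace.single x (1 : ℝ))| ≤ Hk x z) (hHk0 : ∀ v u, 0 ≤ Hk
        v u) (hK3 : ∀ (φ : EuclideanSpace ℝ ι) (u x y : ι), |U₃ φ (EuclideanSpace.single u (1 : ℝ)) (EuclideanSpace.single x (1 : ℝ))
        (EuclideanSpace.single y (1 : ℝ))| ≤ K3 x y u) (hK30 : ∀ x y u, 0 ≤ K3 x y u) (ψ : EuclideanSpace ℝ ι) (hαr : ∀ u, ∑ w, |A u w| ≤ αr) (hαc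
        : ∀ w, ∑ u, |A u w| ≤ αc) (hhr : ∀ v, ∑ u, Hk v u ≤ hr) (hlamA : ∀ x : κ, ∑ u, ∑ v, |A u x| * |A v x| * Hk v u ≤ lamA) (hlamA1 : lamA < 1)
        (hγ : αc * hr * αr / (1 - lamA) ≤ γ) (hγ1 : γ < 1) (hD : ∀ x y, 0 ≤ D x y) (hDC : ∀ x y, (if x = y then (1 : ℝ) else 0) + ∑ z, D x z * ((if
        y = z then 0 else ∑ u, ∑ v, |A u y| * |A v z| * Hk v u) / (1 - lamA)) ≤ D x y) (hθnn : ∀ z w, 0 ≤ θ z w) (hDr : ∀ z, ∑ w, D z w * θ z w ≤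
        dθ) (hdθ : 0 ≤ dθ) (hDc : ∀ w, ∑ z, D z w * θ z w ≤ dθ') (hdθ' : 0 ≤ dθ') (hσ0 : ∀ x w, 0 ≤ σ x w) (hσθ : ∀ x z w, σ x w ≤ σ x z * θ z w)
        (hρ1 : ∀ x y, 1 ≤ ρ x y) (hρsymm : ∀ x y, ρ x y = ρ y x) (hρmul : ∀ x y z, ρ x z ≤ ρ x y * ρ y z) (hρσ : ∀ x y w, ρ x y ^ 8 ≤ σ x w * σ y
        w) (haσ : ∀ v : ι, ∑ w, (∑ u, |A u w| * Hk v u) * σ v w ≤ αθ) (hβ : 0 ≤ βθ) (haσ' : ∀ (v : ι) (w : κ), (∑ u, |A u w| * Hk v u) * σ v w ≤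
        βθ) (x y : ι) (hgσ : ∑ w, (∑ u, |A u w| * K3 x y u) * σ x w ≤ αθ) (hgσ' : ∀ w : κ, (∑ u, |A u w| * K3 x y u) * σ x w ≤ βθ) (z t : ι) :
    |(∫ ω : EuclideanSpace ℝ ι, exp (-U (ω + ψ)) ∂(multivariateGaussian 0 (A * Aᵀ)))⁻¹ * (∫ ω : EuclideanSpace ℝ ι, exp (-U (ω + ψ)) * ((U'' (ω +
        ψ) (EuclideanSpace.single x (1 : ℝ)) (EuclideanSpace.single y (1 : ℝ)) - ((∫ ω : EuclideanSpace ℝ ι, exp (-U (ω + ψ))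
        ∂(multivariateGaussian 0 (A * Aᵀ)))⁻¹ * (∫ ω : EuclideanSpace ℝ ι, exp (-U (ω + ψ)) * U'' (ω + ψ) (EuclideanSpace.single x (1 : ℝ))
        (EuclideanSpace.single y (1 : ℝ)) ∂(multivariateGaussian 0 (A * Aᵀ))))) * (U' (ω + ψ) (EuclideanSpace.single z (1 : ℝ)) - ((∫ ω :
        EuclideanSpace ℝ ι, exp (-U (ω + ψ)) ∂(multivariateGaussian 0 (A * Aᵀ)))⁻¹ * (∫ ω : EuclideanSpace ℝ ι, exp (-U (ω + ψ)) * U' (ω + ψ)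
        (EuclideanSpace.single z (1 : ℝ)) ∂(multivariateGaussian 0 (A * Aᵀ))))) * (U' (ω + ψ) (EuclideanSpace.single t (1 : ℝ)) - ((∫ ω :
        EuclideanSpace ℝ ι, exp (-U (ω + ψ)) ∂(multivariateGaussian 0 (A * Aᵀ)))⁻¹ * (∫ ω : EuclideanSpace ℝ ι, exp (-U (ω + ψ)) * U' (ω + ψ)
        (EuclideanSpace.single t (1 : ℝ)) ∂(multivariateGaussian 0 (A * Aᵀ)))))) ∂(multivariateGaussian 0 (A * Aᵀ)))| ≤
      Real.sqrt (2 * Hk y x * Real.sqrt (5 * (κ₂ ^ 4 * γop ^ 2) / (1 - lam * γop) ^ 2) * (4 * Real.sqrt ((5 * ((κ₂ ^ 4 + κ₃ ^ 4) * γop ^ 2) / (1 -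
        lam * γop) ^ 2) * (αθ * dθ * (βθ * dθ') / (1 - lamA))))) / Real.sqrt (ρ x z * ρ x t) := by
  have hU''c : Continuous U'' := continuous_iff_continuousAt.2 fun φ => (hU''d φ).continuousAt
  have hP := homogeneous_mixed_third_cumulant_entry hΓop Y hUd hU'd hU''c hκ₀ hκ₁ ha hτ hδ hθ0 hθ1 hκθ hstab hU'b hU''b hlam hUsec hρg hHk ψ
    x y z t
  have hQ := whitened_mixed_third_cumulant_entry hΓop Y hUd hU'd hU''d hU₃c hκ₀ hκ₁ ha hτ hδ hθ0 hθ1 hκθ hκθw hstab hU'b hU''b hU₃b hlam hUsec hρg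
        hHk hHk0 hK3 hK30 ψ hαr hαc hhr hlamA hlamA1 hγ hγ1 hD hDC hθnn hDr hdθ hDc hdθ' hσ0 hσθ hρ1 hρsymm hρmul hρσ haσ hβ haσ' x y hgσ hgσ' z t
  have h := abs_le_sqrt_mul_of_le hP hQ
  have hHkyx : 0 ≤ Hk y x := (abs_nonneg _).trans (hHk ψ y x)
  rw [← mul_div_assoc, Real.sqrt_div (by positivity)] at h
  exact h

end Whitened

/-! ## §5. Toy -/

/-- Toy (§1 in numbers): a vertex bounded by `1` (`β = ½`) against fourth moments `≤ 16` gives `2·½·√16 = 4`. -/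
example : 2 * (1 / 2 : ℝ) * Real.sqrt 16 = 4 := by
  rw [show (16 : ℝ) = 4 ^ 2 by norm_num, Real.sqrt_sq (by norm_num)]; norm_num

end Summit.QuantumFields.BalabanUV.T4Continuum.NE7b.SupHomogeneousThreePoint

end
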